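import Literature.NumberTheory.Automorphic.TwistedQuotientConeDescent
import Summits.Langlands.Langlands.Theorems.IrreducibilityBySelfDualityHeckeEigenvalueFieldStubConePeriodRec
import Literature.Analysis.Calculus.ConePeriodLinear
import HarnessLib

/-!
# The bottom corner of the staircase is the cone cocycle — crux HeckeEigenvalueField
# (stmt-Langlands-13632), line Sketch, stub `stub_delta_stair_bottom`

Setting of `Literature.NumberTheory.Automorphic.TwistedQuotientConeDescent`: a linear action
`a : Γ →* (W →L[ℝ] W)`, a convex `X ⊆ W` containing the orbit of the base point `x₀`, a family
`ω c` (`c ∈ 𝒢`) of `(q+1)`-forms, and the STAIRCASE `κ⁽ᵖ⁾ = stair p` of the double complex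
(`κ⁽⁰⁾(g₀) = K_{a(g₀)x₀} S`, `κ⁽ᵖ⁺¹⁾ = K δκ⁽ᵖ⁾` for a total family `S`, the radial homotopy operator
`K_y β x = ∫₀¹ t^k ι_{x-y} β(y + t(x-y)) dt` of `Literature.Geometry.Kaehler.PoincareLemmaFlat` being
centred at the LAST vertex `a(g_p) x₀`).

Statement.  For `S = single ω` (the family `ω` placed in degree `q+1`), the degree-`0` component of
`δκ⁽q⁾(g₀, …, g_{q+1})`, evaluated at the last vertex `a(g_{q+1}) x₀`, is `(-1)^{(q+1)(q+2)/2}` times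
the constant `0`-form on the cone period of `ω` over the straight simplex
`[a(g₀)x₀, …, a(g_{q+1})x₀]`, i.e. on the value of the homogeneous cone cochain
`TwistedQuotient.coneCochain L a ω x₀ g` of `TwistedQuotientConeClass`.

Proof.
* `(K_y β)(y) = 0` and `ι_{x-y} (K_y β)(y + t(x-y)) = 0` identically (`coneOperator_apply_self`,
  `curryLeft_coneOperator_radial`: the vector `x - y` is zero, resp. would be inserted twice; no
  integrability is needed, a divergent Bochner integral being `0`).  Every `κ⁽ᵖ⁾(g)` is a radial
  primitive centred at `a(g_p)x₀` (`exists_stair_eq`), so in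
  `κ⁽ᵖ⁺¹⁾(g) = K_{a(g_{p+1})x₀} ∑ᵢ (-1)ⁱ κ⁽ᵖ⁾(g ∘ σᵢ)` the faces `i ≤ p`, which keep the vertex `g_{p+1}`,
  are killed, and ON THE NOSE `κ⁽ᵖ⁺¹⁾(g) = (-1)^{p+1} K_{a(g_{p+1})x₀} κ⁽ᵖ⁾(g₀, …, g_p)`
  (`stair_succ_eq_last`); likewise only the last face of `δκ⁽q⁾` survives at the vertex
  `a(g_{q+1})x₀` (`stair_apply_eq_zero`).
* Peeling the FIRST vertex instead: `κ⁽ᵖ⁺¹⁾_S(g₀, …, g_{p+1}) = (-1)^{p+1} κ⁽ᵖ⁾_{K_{a(g₀)x₀} S}(g₁, …, g_{p+1})`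
  (`stair_succ_eq_first`, induction from the previous point), which matches the recursion of cone
  periods `conePeriod (n+1) ω (x₀, …) = conePeriod n (K_{x₀} ω) (x₁, …)` (the landed stub
  `stub_conePeriod_succ_eq_coneOperator`, one Fubini per vertex); by induction
  `conePeriod (q+1) (S (q+1)) (a(g₀)x₀, …, a(g_{q+1})x₀) = ε_q conePeriod 0 (κ⁽q⁾_S(g₀, …, g_q)) (a(g_{q+1})x₀)`,
  `ε_p = (-1)^{p(p+1)/2}` (`conePeriod_stair`), the continuity of the intermediate forms on `X` being
  that of the staircase components (hypothesis).  A cone period in degree `0` is an evaluation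
  (`conePeriod_zero_eq_apply`), and `(-1)^{q+1} ε_q = ε_{q+1}` (`sign_step`).

## References

* J. L. Dupont, *Simplicial de Rham cohomology and characteristic classes of flat bundles*,
  Topology 15 (1976), 233–245, §1–2. [Dupont1976]
* R. Bott, L. W. Tu, *Differential Forms in Algebraic Topology*, GTM 82 (1982), §I.4 (the homotopy
  operator), §II.9 (the staircase / collating formula). [BottTu1982Forms]
-/

set_option linter.dupNamespace false -- project-wide: `Summit.Langlands.Langlands` is the mandated namespace

noncomputable section

open Set MeasureTheory
open Literature.NumberTheory.Automorphic Literature.Analysis.Calculus Literature.Geometry.Kaehler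

namespace Summit.Langlands.Langlands.Theorems.HeckeEigenvalueField.Res

namespace StairBottom

section Helpers

variable {E : Type*} [NormedAddCommGroup E] [NormedSpace ℝ E]
  {F : Type*} [NormedAddCommGroup F] [NormedSpace ℝ F]

/-! ### The radial homotopy operator: `(K_y β)(y) = 0` and `ι_{x-y} ∘ K_y = 0` along rays -/

/-- **`(K_y β)(y) = 0`**: at its own centre the radial primitive vanishes (the inserted vector
`y - y` is zero). [cite: BottTu1982Forms, §I.4] -/
theorem coneOperator_apply_self {k : ℕ} (y : E) (β : E → E [⋀^Fin (k + 1)]→L[ℝ] F) :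
    coneOperator y β y = 0 := by
  simp [coneOperator, coneIntegrand]

/-- **`K_y ∘ K_y = 0`, pointwise form**: along the ray from the centre `y` through `x`, the
radial primitive `K_y β` is annihilated by the insertion of `x - y` (the vector `x - y` would be
inserted twice into the alternating form `β`).  No integrability is needed: a divergent integral
is `0`. [cite: BottTu1982Forms, §I.4] -/
theorem curryLeft_coneOperator_radial [CompleteSpace F] {k : ℕ} (y : E)
    (β : E → E [⋀^Fin (k + 2)]→L[ℝ] F) (t : ℝ) (x : E) :
    ((coneOperator y β) (y + t • (x - y))).curryLeft (x - y) = 0 := by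
  have hzy : y + t • (x - y) - y = t • (x - y) := by abel
  by_cases hi : IntervalIntegrable (fun s : ℝ => coneIntegrand y β (s, y + t • (x - y))) volume 0 1
  · -- insertion of `x - y` is a continuous linear map and commutes with the integral
    set T : (E [⋀^Fin (k + 1)]→L[ℝ] F) →L[ℝ] (E [⋀^Fin k]→L[ℝ] F) :=
      (ContinuousLinearMap.apply ℝ (E [⋀^Fin k]→L[ℝ] F) (x - y)).comp
        (ContinuousAlternatingMap.curryLeftLI (𝕜 := ℝ) (E := E) (F := F)
          (n := k)).toContinuousLinearMap
    have hTapp : ∀ f : E [⋀^Fin (k + 1)]→L[ℝ] F, T f = f.curryLeft (x - y) := fun f => rfl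
    rw [coneOperator, ← hTapp, ← T.intervalIntegral_comp_comm hi]
    simp only [hTapp, coneIntegrand, hzy, ContinuousAlternatingMap.curryLeft_smul, map_smul,
      smul_apply, ContinuousAlternatingMap.curryLeft_same, smul_zero]
    simp
  · rw [coneOperator, intervalIntegral.integral_undef hi, ContinuousAlternatingMap.curryLeft_zero]
    rfl

/-- Insertion of a vector commutes with finite sums of forms. [folklore] -/
theorem curryLeft_sum {n : ℕ} {ι' : Type*} (s : Finset ι') (f : ι' → E [⋀^Fin (n + 1)]→L[ℝ] F)
    (w : E) : (∑ i ∈ s, f i).curryLeft w = ∑ i ∈ s, (f i).curryLeft w := by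
  induction s using Finset.cons_induction with
  | empty => simp
  | cons i s hi ih => simp [Finset.sum_cons, ih]

/-! ### Cone periods in degree `0`, constant `0`-forms, signs -/

/-- **A cone period in degree `0` is an evaluation**: `conePeriod 0 θ (z₀) = θ(z₀)` (the cube
`[0,1]^0` is a point of volume `1`). [cite: Dupont1976, §1] -/
theorem conePeriod_zero_eq_apply [CompleteSpace F] (θ : E → E [⋀^Fin 0]→L[ℝ] F) (z : Fin 1 → E)
    (v : Fin 0 → E) : conePeriod 0 θ z = θ (z 0) v := by
  rw [conePeriod_def]
  have h : ∀ t : Fin 0 → ℝ, θ (coneCube 0 z t)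
      (fun j => fderiv ℝ (coneCube 0 z) t (Pi.single j 1)) = θ (z 0) v := by
    intro t
    rw [coneCube_zero]
    congr 1
    exact Subsingleton.elim _ _
  simp only [h]
  rw [setIntegral_const, measureReal_def, Real.volume_Icc_pi_toReal zero_le_one]
  simp

/-- A `0`-form is the constant `0`-form on its (unique) value. [folklore] -/
theorem eq_constOfIsEmpty (θ : E [⋀^Fin 0]→L[ℝ] F) (v : Fin 0 → E) :
    θ = ContinuousAlternatingMap.constOfIsEmpty ℝ E (Fin 0) (θ v) := by
  ext u
  rw [ContinuousAlternatingMap.constOfIsEmpty_apply, Subsingleton.elim u v]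

/-- The constant `0`-form depends linearly on its value. [folklore] -/
theorem constOfIsEmpty_smul (c : ℝ) (m : F) :
    ContinuousAlternatingMap.constOfIsEmpty ℝ E (Fin 0) (c • m) =
      c • ContinuousAlternatingMap.constOfIsEmpty ℝ E (Fin 0) m := by
  ext u
  simp

/-- The signs of the staircase: `(-1)^{p+1} ε_p = ε_{p+1}` for `ε_p = (-1)^{p(p+1)/2}`.
[folklore] -/
theorem sign_step (p : ℕ) :
    (-1 : ℝ) ^ (p + 1) * (-1) ^ (p * (p + 1) / 2) = (-1) ^ ((p + 1) * (p + 2) / 2) := by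
  have h : (p + 1) * (p + 2) / 2 = p * (p + 1) / 2 + (p + 1) := by
    have : (p + 1) * (p + 2) = p * (p + 1) + (p + 1) * 2 := by ring
    rw [this, Nat.add_mul_div_right _ _ two_pos]
  rw [h, pow_add (-1 : ℝ) (p * (p + 1) / 2) (p + 1), mul_comm]

/-- The signs of the staircase, read backwards: `ε_{p+1} (-1)^{p+1} = ε_p`. [folklore] -/
theorem sign_step' (p : ℕ) :
    (-1 : ℝ) ^ ((p + 1) * (p + 1 + 1) / 2) * (-1) ^ (p + 1) = (-1) ^ (p * (p + 1) / 2) := by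
  rw [← sign_step p, mul_comm ((-1 : ℝ) ^ (p + 1)), mul_assoc, ← mul_pow, neg_one_mul, neg_neg,
    one_pow, mul_one]

end Helpers

/-! ### The staircase: closed recursions in the last and in the first vertex -/

section Stair

variable {Γ 𝒢 : Type} [Group Γ] [Group 𝒢] (L : Subgroup 𝒢)
  {V : Type} [NormedAddCommGroup V] [NormedSpace ℂ V] [CompleteSpace V]
  {W : Type} [NormedAddCommGroup W] [NormedSpace ℝ W]
  (a : Γ →* (W →L[ℝ] W))

omit [CompleteSpace V] in
/-- Every staircase component `κ⁽ᵖ⁾(g₀, …, g_p)` is, degreewise, a radial primitive centred at the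
last vertex `a(g_p) x₀`. [cite: BottTu1982Forms, §II.9] -/
theorem exists_stair_eq (S : TwistedQuotient.TFam L W V) (x₀ : W) :
    ∀ (p : ℕ) (g : Fin (p + 1) → Γ) (c : 𝒢 ⧸ L) (r : ℕ),
      ∃ β : W → W [⋀^Fin (r + 1)]→L[ℝ] V,
        TwistedQuotient.stair L a S x₀ p g c r = coneOperator (a (g (Fin.last p)) x₀) β
  | 0, _, c, r => ⟨S c (r + 1), rfl⟩
  | p + 1, g, c, r => ⟨TwistedQuotient.delta L (TwistedQuotient.stair L a S x₀ p) g c (r + 1), rfl⟩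

omit [CompleteSpace V] in
/-- A staircase component vanishes at its last vertex: `κ⁽ᵖ⁾(g₀, …, g_p)(a(g_p) x₀) = 0`.
[cite: BottTu1982Forms, §I.4] -/
theorem stair_apply_eq_zero (S : TwistedQuotient.TFam L W V) (x₀ : W) (p : ℕ) (g : Fin (p + 1) → Γ)
    (c : 𝒢 ⧸ L) (r : ℕ) {Y : W} (hY : a (g (Fin.last p)) x₀ = Y) :
    TwistedQuotient.stair L a S x₀ p g c r Y = 0 := by
  obtain ⟨β, hβ⟩ := exists_stair_eq L a S x₀ p g c r
  rw [hβ, hY, coneOperator_apply_self]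

/-- **The staircase recursion in closed form (last vertex)**:
`κ⁽ᵖ⁺¹⁾(g₀, …, g_{p+1}) = (-1)^{p+1} K_{a(g_{p+1})x₀} κ⁽ᵖ⁾(g₀, …, g_p)` identically (every degree,
every point) — in `κ⁽ᵖ⁺¹⁾(g) = K_{a(g_{p+1})x₀} ∑ᵢ (-1)ⁱ κ⁽ᵖ⁾(g ∘ σᵢ)` the faces `i ≤ p` keep the vertex
`g_{p+1}`, so they are radial primitives centred at `a(g_{p+1})x₀` and are killed by the outer
`K_{a(g_{p+1})x₀}` (`K_y ∘ K_y = 0`). [cite: BottTu1982Forms, §II.9] [cite: Dupont1976, §1–2] -/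
theorem stair_succ_eq_last (S : TwistedQuotient.TFam L W V) (x₀ : W) (p : ℕ) (g : Fin (p + 2) → Γ)
    (c : 𝒢 ⧸ L) (r : ℕ) :
    TwistedQuotient.stair L a S x₀ (p + 1) g c r =
      ((-1 : ℝ) ^ (p + 1)) • coneOperator (a (g (Fin.last (p + 1))) x₀)
        (TwistedQuotient.stair L a S x₀ p (fun i => g (Fin.castSucc i)) c (r + 1)) := by
  funext x
  rw [TwistedQuotient.stair_succ, TwistedQuotient.cochK_apply, TwistedQuotient.famK_apply,
    Pi.smul_apply]
  -- the faces through the last vertex are radial primitives centred there, hence killed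
  have hvan : ∀ (t : ℝ) (i : Fin (p + 1)),
      ((TwistedQuotient.stair L a S x₀ p (fun j => g ((Fin.castSucc i).succAbove j)) c (r + 1))
        (a (g (Fin.last (p + 1))) x₀ + t • (x - a (g (Fin.last (p + 1))) x₀))).curryLeft
        (x - a (g (Fin.last (p + 1))) x₀) = 0 := by
    intro t i
    obtain ⟨β, hβ⟩ :=
      exists_stair_eq L a S x₀ p (fun j => g ((Fin.castSucc i).succAbove j)) c (r + 1)
    -- the face `σ_{castSucc i}` keeps the last vertex: `σ_{castSucc i}(last p) = last (p+1)`
    rw [hβ, Fin.succAbove_castSucc_of_le _ _ (Fin.le_last i), Fin.succ_last]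
    exact curryLeft_coneOperator_radial _ β t x
  -- so the integrands of `K (δκ⁽ᵖ⁾)` and of `K ((-1)^{p+1} • last face)` agree pointwise
  have hint : ∀ t : ℝ, coneIntegrand (a (g (Fin.last (p + 1))) x₀)
      (TwistedQuotient.delta L (TwistedQuotient.stair L a S x₀ p) g c (r + 1)) (t, x) =
      coneIntegrand (a (g (Fin.last (p + 1))) x₀)
        (((-1 : ℝ) ^ (p + 1)) •
          TwistedQuotient.stair L a S x₀ p (fun i => g (Fin.castSucc i)) c (r + 1)) (t, x) := by
    intro t
    simp only [coneIntegrand, TwistedQuotient.delta_apply, Finset.sum_apply, Pi.smul_apply,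
      curryLeft_sum, ContinuousAlternatingMap.curryLeft_smul, smul_apply]
    rw [Fin.sum_univ_castSucc]
    simp [hvan, Fin.succAbove_last]
  have hC : coneOperator (a (g (Fin.last (p + 1))) x₀)
      (TwistedQuotient.delta L (TwistedQuotient.stair L a S x₀ p) g c (r + 1)) x =
      coneOperator (a (g (Fin.last (p + 1))) x₀)
        (((-1 : ℝ) ^ (p + 1)) •
          TwistedQuotient.stair L a S x₀ p (fun i => g (Fin.castSucc i)) c (r + 1)) x := by
    simp only [coneOperator]
    exact intervalIntegral.integral_congr fun t _ => hint t
  rw [hC, coneOperator_smul, Pi.smul_apply]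

/-- **The staircase recursion in the first vertex**:
`κ⁽ᵖ⁺¹⁾_S(g₀, …, g_{p+1}) = (-1)^{p+1} κ⁽ᵖ⁾_{K_{a(g₀)x₀} S}(g₁, …, g_{p+1})` — the staircase of `S` along
`(g₀, …, g_{p+1})` is, up to sign, the staircase of the family `K_{a(g₀)x₀} S` (`TwistedQuotient.famK`)
along `(g₁, …, g_{p+1})`; by induction from `stair_succ_eq_last`.
[cite: BottTu1982Forms, §II.9] [cite: Dupont1976, §1–2] -/
theorem stair_succ_eq_first (S : TwistedQuotient.TFam L W V) (x₀ : W) :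
    ∀ (p : ℕ) (g : Fin (p + 2) → Γ) (c : 𝒢 ⧸ L) (r : ℕ),
      TwistedQuotient.stair L a S x₀ (p + 1) g c r =
        ((-1 : ℝ) ^ (p + 1)) •
          TwistedQuotient.stair L a (TwistedQuotient.famK L (a (g 0) x₀) S) x₀ p
            (fun i => g i.succ) c r
  | 0, g, c, r => by
      have e1 : (Fin.last 1 : Fin 2) = 1 := rfl
      rw [stair_succ_eq_last]
      simp [e1]
  | p + 1, g, c, r => by
      have IH := stair_succ_eq_first S x₀ p (fun i => g (Fin.castSucc i)) c (r + 1)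
      rw [stair_succ_eq_last, IH, Fin.castSucc_zero, coneOperator_smul, smul_smul,
        stair_succ_eq_last]
      simp only [Fin.succ_last, Fin.succ_castSucc, smul_smul]

/-- **Cone periods are iterated radial primitives, staircase form** (the landed
`stub_conePeriod_succ_eq_coneOperator` iterated along `stair_succ_eq_first`): for a total family `S`
with `S c n` continuous on the convex `X` (`n = p + m + 1`), a sequence `g₀, g₁, …` in `Γ` (the orbit
of `x₀` lying in `X`), and staircase components `κ⁽ʲ⁾_S(g₀, …, g_j)` (`j < p`) continuous on `X` in the
relevant degree,
`conePeriod n (S c n) (a(g₀)x₀, …, a(g_n)x₀) = ε_p conePeriod m (κ⁽ᵖ⁾_S(g₀, …, g_p) c m) (a(g_{p+1})x₀, …, a(g_n)x₀)`,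
`ε_p = (-1)^{p(p+1)/2}`.  The group elements are read off a sequence `ℕ → Γ` to keep the degree
arithmetic out of the types. [cite: Dupont1976, §1–2] [cite: BottTu1982Forms, §I.4] -/
theorem conePeriod_stair [FiniteDimensional ℝ W] {X : Set W} (hXc : Convex ℝ X) (x₀ : W)
    (hpts : ∀ γ : Γ, a γ x₀ ∈ X) (c : 𝒢 ⧸ L) :
    ∀ (p n m : ℕ) (gs : ℕ → Γ) (S : TwistedQuotient.TFam L W V), n = p + m + 1 →
      ContinuousOn (S c n) X →
      (∀ j d : ℕ, j + 1 ≤ p → j + d + 1 = n →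
        ContinuousOn (TwistedQuotient.stair L a S x₀ j (fun i : Fin (j + 1) => gs i) c d) X) →
      conePeriod n (S c n) (fun i : Fin (n + 1) => a (gs i) x₀) =
        ((-1 : ℝ) ^ (p * (p + 1) / 2)) •
          conePeriod m (TwistedQuotient.stair L a S x₀ p (fun i : Fin (p + 1) => gs i) c m)
            (fun j : Fin (m + 1) => a (gs (p + 1 + j)) x₀)
  | 0, n, m, gs, S, hn, hS, _ => by
      obtain rfl : n = m + 1 := by omega
      rw [stub_conePeriod_succ_eq_coneOperator hXc m (S c (m + 1)) hS _ fun i => hpts _]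
      have e : (fun j : Fin (m + 1) => a (gs (0 + 1 + (j : ℕ))) x₀) =
          fun j : Fin (m + 1) => a (gs ((j : ℕ) + 1)) x₀ := by
        funext j; rw [show 0 + 1 + (j : ℕ) = j + 1 by omega]
      rw [e]
      simp
  | p + 1, n, m, gs, S, hn, hS, hcont => by
      obtain rfl : n = p + m + 1 + 1 := by omega
      rw [stub_conePeriod_succ_eq_coneOperator hXc (p + m + 1) (S c (p + m + 1 + 1)) hS _
        fun i => hpts _]
      -- the hypotheses for the family `K_{a(g₀)x₀} S` along `(g₁, g₂, …)`
      have hS' : ContinuousOn (TwistedQuotient.famK L (a (gs 0) x₀) S c (p + m + 1)) X :=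
        hcont 0 (p + m + 1) (by omega) (by omega)
      have hcont' : ∀ j d : ℕ, j + 1 ≤ p → j + d + 1 = p + m + 1 →
          ContinuousOn (TwistedQuotient.stair L a (TwistedQuotient.famK L (a (gs 0) x₀) S) x₀ j
            (fun i : Fin (j + 1) => gs (i + 1)) c d) X := by
        intro j d hj hjd
        have h := hcont (j + 1) d (by omega) (by omega)
        rw [stair_succ_eq_first] at h
        have h2 := h.const_smul ((-1 : ℝ) ^ (j + 1))
        rw [smul_smul, ← mul_pow, neg_one_mul, neg_neg, one_pow, one_smul] at h2
        exact h2
      have IH := conePeriod_stair hXc x₀ hpts c p (p + m + 1) m (fun i => gs (i + 1))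
        (TwistedQuotient.famK L (a (gs 0) x₀) S) rfl hS' hcont'
      have e : (fun j : Fin (m + 1) => a (gs (p + 1 + 1 + (j : ℕ))) x₀) =
          fun j : Fin (m + 1) => a (gs (p + 1 + (j : ℕ) + 1)) x₀ := by
        funext j; rw [show p + 1 + 1 + (j : ℕ) = p + 1 + j + 1 by omega]
      rw [stair_succ_eq_first, conePeriod_smul, smul_smul, sign_step', e]
      exact IH

end Stair

end StairBottom

open StairBottom in
/-- **Stub BOTTOM — the bottom corner of the staircase is the cone cocycle (pointwise, at the last
vertex).**  For a family `ω` of `(q+1)`-forms, `C^∞` on the open convex `X` (which contains the orbit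
of the base point `x₀`), the staircase `κ⁽ᵖ⁾ = stair p` of `TwistedQuotientConeDescent` (radial
primitives centred at the last vertex) is `κ⁽ᵖ⁾(g₀,…,g_p) = ε_p K_{a(g_p)x₀} ⋯ K_{a(g₀)x₀} ω` with
`ε_p = (-1)^{p(p+1)/2}` (`K_y K_y = 0`), and its simplicial coboundary in degree `0`, evaluated at the
last vertex `a(g_{q+1}) x₀` (where every term centred there vanishes), is
`(-1)^{q+1} ε_q (K ⋯ K ω)(a(g_{q+1})x₀) = (-1)^{(q+1)(q+2)/2} ×` the cone period of `ω` over
`[a(g₀)x₀, …, a(g_{q+1})x₀]` (`stub_conePeriod_succ_eq_coneOperator` iterated, the continuity of the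
intermediate forms on `X` being that of the staircase components, a hypothesis here and a theorem
of the tower file), as the constant `0`-form on the value of `TwistedQuotient.coneCochain L a ω x₀ g`.
Openness of `X` is part of the registered signature but is not needed for the identity.
[cite: Dupont1976, §1–2] [cite: BottTu1982Forms, §II.9] -/
theorem stub_delta_stair_bottom
    {Γ 𝒢 : Type} [Group Γ] [Group 𝒢] (L : Subgroup 𝒢)
    {V : Type} [NormedAddCommGroup V] [NormedSpace ℂ V] [CompleteSpace V]
    {W : Type} [NormedAddCommGroup W] [NormedSpace ℝ W] [FiniteDimensional ℝ W]
    (a : Γ →* (W →L[ℝ] W)) {X : Set W} (hXo : IsOpen X) (hXc : Convex ℝ X)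
    {x₀ : W} (hpts : ∀ γ : Γ, a γ x₀ ∈ X) {q : ℕ} (ω : 𝒢 → W → W [⋀^Fin (q + 1)]→L[ℝ] V)
    (hωs : ∀ c : 𝒢, ContDiffOn ℝ ((⊤ : ℕ∞) : WithTop ℕ∞) (ω c) X)
    (hstair : ∀ p ≤ q, ∀ (g' : Fin (p + 1) → Γ) (c' : 𝒢 ⧸ L) (r : ℕ), ContinuousOn
      (TwistedQuotient.stair L a (TwistedQuotient.single L fun c'' : 𝒢 ⧸ L => ω c''.out) x₀ p g' c' r) X)
    (g : Fin (q + 2) → Γ) (c : 𝒢 ⧸ L) :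
    TwistedQuotient.delta L
        (TwistedQuotient.stair L a (TwistedQuotient.single L fun c' : 𝒢 ⧸ L => ω c'.out) x₀ q)
        g c 0 (a (g (Fin.last (q + 1))) x₀) =
      ((-1 : ℝ) ^ ((q + 1) * (q + 2) / 2)) •
        ContinuousAlternatingMap.constOfIsEmpty ℝ W (Fin 0) (TwistedQuotient.coneCochain L a ω x₀ g c) := by
  have _ := hXo -- part of the registered signature; the identity holds on any convex `X`
  -- Step 1: at the last vertex only the last face of `δκ⁽q⁾` survives
  have hvan : ∀ i : Fin (q + 1),
      TwistedQuotient.stair L a (TwistedQuotient.single L fun c' : 𝒢 ⧸ L => ω c'.out) x₀ q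
        (fun j => g ((Fin.castSucc i).succAbove j)) c 0 (a (g (Fin.last (q + 1))) x₀) = 0 :=
    fun i => stair_apply_eq_zero L a _ x₀ q _ c 0 (by simp)
  have h1 : TwistedQuotient.delta L
      (TwistedQuotient.stair L a (TwistedQuotient.single L fun c' : 𝒢 ⧸ L => ω c'.out) x₀ q)
        g c 0 (a (g (Fin.last (q + 1))) x₀) =
      ((-1 : ℝ) ^ (q + 1)) •
        TwistedQuotient.stair L a (TwistedQuotient.single L fun c' : 𝒢 ⧸ L => ω c'.out) x₀ q
          (fun j => g (Fin.castSucc j)) c 0 (a (g (Fin.last (q + 1))) x₀) := by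
    simp only [TwistedQuotient.delta_apply, Finset.sum_apply, Pi.smul_apply]
    rw [Fin.sum_univ_castSucc]
    simp [hvan, Fin.succAbove_last]
  -- Step 2: the last face, at the last vertex, is `ε_q` times the cone period over the simplex
  obtain ⟨gs, hgs⟩ : ∃ gs : ℕ → Γ, ∀ (n : ℕ) (h : n < q + 2), gs n = g ⟨n, h⟩ :=
    ⟨fun n => if h : n < q + 2 then g ⟨n, h⟩ else g 0, fun n h => dif_pos h⟩
  have hg2 : (fun i : Fin (q + 2) => a (gs i) x₀) = fun i => a (g i) x₀ := by
    funext i; rw [hgs i i.isLt]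
  have hg1 : (fun i : Fin (q + 1) => gs i) = fun i => g (Fin.castSucc i) := by
    funext i; rw [hgs i (by omega)]; rfl
  have hg0 : (fun j : Fin (0 + 1) => a (gs (q + 1 + (j : ℕ))) x₀) =
      fun _ => a (g (Fin.last (q + 1))) x₀ := by
    funext j
    have hj : q + 1 + (j : ℕ) = q + 1 := by have := j.isLt; omega
    rw [hj, hgs (q + 1) (by omega)]
    rfl
  have hcontω : ContinuousOn
      ((TwistedQuotient.single L fun c' : 𝒢 ⧸ L => ω c'.out) c (q + 1)) X := by
    rw [TwistedQuotient.single_self]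
    exact (hωs c.out).continuousOn
  have key := conePeriod_stair L a hXc x₀ hpts c q (q + 1) 0 gs
    (TwistedQuotient.single L fun c' : 𝒢 ⧸ L => ω c'.out) (by omega) hcontω
    (fun j d hj _ => hstair j (by omega) _ c d)
  rw [hg2, hg1, hg0, TwistedQuotient.single_self] at key
  have hθ : TwistedQuotient.stair L a (TwistedQuotient.single L fun c' : 𝒢 ⧸ L => ω c'.out) x₀ q
      (fun j => g (Fin.castSucc j)) c 0 (a (g (Fin.last (q + 1))) x₀) =
      ((-1 : ℝ) ^ (q * (q + 1) / 2)) •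
        ContinuousAlternatingMap.constOfIsEmpty ℝ W (Fin 0)
          (TwistedQuotient.coneCochain L a ω x₀ g c) := by
    rw [eq_constOfIsEmpty (TwistedQuotient.stair L a _ x₀ q _ c 0 _) Fin.elim0,
      ← constOfIsEmpty_smul]
    congr 1
    -- Step 3: a cone period in degree `0` is an evaluation
    rw [← conePeriod_zero_eq_apply _ (fun _ : Fin 1 => a (g (Fin.last (q + 1))) x₀) Fin.elim0,
      TwistedQuotient.coneCochain_apply, key, smul_smul, ← mul_pow, neg_one_mul, neg_neg, one_pow,
      one_smul]
  rw [h1, hθ, smul_smul, sign_step q]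

end Summit.Langlands.Langlands.Theorems.HeckeEigenvalueField.Res

end
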